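import Summits.HubbardSuperconductivity.HubbardSuperconductivity.Theorems.WindowGap.Negative.FreeWindowCalibration
import Literature.MathematicalPhysics.QuantumLattice.HubbardPairDensityCouplingFloor

/-!
# Crux `WindowGap` (stmt-HubbardSuperconductivity-1088), negative side: the INTERACTION BUDGET —
# the window excess is paid out of the repulsion, `λ·a ≤ U`

Negative-side support for the crux `KacWindowPenalty.WindowGap` (route `KacWindowPenalty`; line lead
c4, 2026-08-16). With `H_U = hubbardTorus 2 L 1 U`, `K = szSector (2n) 0` and the crux's Kac-window pair
penalty `W_ε = L⁻² Σ_{|q_m| ≤ ε} Δ_d(m)ᴴ Δ_d(m)`, for every `U ≥ 0`, `λ ≥ 0`, `ε` and `n ≤ L²` (`L ≥ 3`):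

  `minEnergyOn (H_U + λW_ε) K − minEnergyOn H_U K ≤ U·L² + 50·λ·#{m : |q_m| ≤ ε}`
  (`windowGap_le_coupling_add_freeWindow`; `≤ U L² + 50λ(2⌊εL/2π⌋ + 1)²`, primed version).

Mechanism: test the penalised interacting operator on a pair-poor FREE sector ground state `ψ`
(`exists_unit_freeGroundState_kacWindow_le`: some normalised ground state of `H_0` in `K` has window
weight `≤ 50·#window`, by the flat free pair structure factor `re_trace_sectorEigenProj_mul_kacWindow_le_free`
of `FreeWindowCalibration` and a pigeonhole over the ground eigenspace); its interacting energy is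
`≤ minEnergyOn H_0 K + U L²` (`0 ≤ Σ_x n_{x↑}n_{x↓} ≤ L²`), while `minEnergyOn H_0 K ≤ minEnergyOn H_U K`
(`minEnergyOn_hubbardTorus_zero_le`). Consequences for witnesses of the crux body at `(U, δ)`:

* `windowGap_coupling_mul_consts_le_coupling` — if `λ(Cε + a)L² ≤ gap_L` for all large even `L`
  (`U, λ, ε ≥ 0`, `δ ≥ −1`), then `λ(Cε + a) ≤ U + 50λε²/π²`;
* `windowGap_coupling_mul_le_coupling` — hence `λ·a ≤ U` as soon as `C ≥ 50ε/π²` (e.g. the crux's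
  adversarial `C ≥ 6 ≥ 50ε₀/π²` with `ε₀ = 1`): THE PENALTY BUDGET OF A WITNESS IS AT MOST THE COUPLING;
* `windowGap_false_uniformly_near_zero_coupling` — so no witness `(ε, λ, a, L₀)` (with `C ≥ 50ε/π²`)
  serves a whole interval of couplings `U ∈ (0, U₀)`: `λ(U)·a(U) → 0` as `U → 0⁺` is forced — the
  `WindowGap` analogue of `LowEnergyRigidity.Negative.lowEnergyRigidity_false_uniformly_near_zero_coupling`,
  interpolating continuously to the free-point refutation `not_windowGapAt_zero` (`U = 0`: `λa ≤ 0`).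

Reading. Together with the landed boxes — WLOG `λ` small (concavity, p99835), `λ(Cε + a) ≤ 4(1−δ)`
(penalty saturation, p122404), `Cε + a ≤ 32` (Parseval, p98536), and the twist ceiling
`gap ≤ 8π²J² + 50λ(2⌊εL/2π⌋+1)L²/(2J+1)` (p105948, which forces `λ(ε) = O(ε²/a³)`) — a witness now lives in
`λ·a ≤ min(U, 4(1−δ))`: at weak coupling the extensive window excess can only be bought with
interaction energy, exactly as the BCS picture (`a ≍ m² ≍ e^{−c/U²}`, `λ ≍ ρ_sε²/m²`) predicts. Nothing here asserts a Theses decl positively; the crux (`∃ U > 0 …`) is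
untouched. No definitions, no named facts; `--supports stmt-HubbardSuperconductivity-1088`.

Sources: J. Bardeen, L. N. Cooper, J. R. Schrieffer, Phys. Rev. 108 (1957) 1175, §II; V. Bach,
E. H. Lieb, J. P. Solovej, J. Stat. Phys. 76 (1994) 3, §2 (positivity of the on-site repulsion);
H. Tasaki, Physics and Mathematics of Quantum Many-Body Systems (2020) §2.1 (variational principle).
Folklore finite-dimensional statements. Tree search: `re_trace_sectorEigenProj_mul_kacWindow_le_free`,
`card_window_le`, `exists_unit_le_re_of_trace_projMatrix_map`, `minEnergyOn_le_re_rayleigh`,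
`hubbardTorus_eq_zero_add_smul_interaction`, `re_expect_interaction_torus_mem_Icc`,
`NoGo.exists_unit_groundStateInSector_hubbardTorus`, `NoGo.floor_pairNumber_le`.
-/

set_option linter.dupNamespace false

noncomputable section

namespace Summit.HubbardSuperconductivity.HubbardSuperconductivity.Theorems.WindowGap.Negative

open Matrix Finset Literature.MathematicalPhysics.QuantumLattice Literature.Probability.LatticeModels
open scoped ComplexOrder ComplexConjugate

variable {L : ℕ} [NeZero L]

/-! ### A pair-poor free ground state -/

/-- **Some free sector ground state is pair-poor in the window.** At `U = 0` (`L ≥ 3`), for every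
`n ≤ L²` and every window radius `ε`, the sector `szSector (2n) 0` contains a normalised ground state
`ψ` of `hubbardTorus 2 L 1 0` with Kac-window weight `Re ⟨ψ, W_ε ψ⟩ ≤ 50 · #{m : |q_m| ≤ ε}`
(pigeonhole over an orthonormal frame of the sector ground eigenspace, whose projection `P` has
`Re tr (P W_ε) ≤ 50 · #window · Re tr P`, `re_trace_sectorEigenProj_mul_kacWindow_le_free`).
Bardeen–Cooper–Schrieffer (1957) §II (the normal Fermi sea carries `O(1)` pair weight per mode).
[folklore] -/
theorem exists_unit_freeGroundState_kacWindow_le (hL : 3 ≤ L) {n : ℕ} (hn : n ≤ L ^ 2) (ε : ℝ) :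
    ∃ ψ : Fock (Orb (FermionTorus 2 L)), star ψ ⬝ᵥ ψ = 1 ∧
      IsGroundStateInSector (hubbardTorus 2 L 1 0) (2 * n) 0 ψ ∧
      (star ψ ⬝ᵥ (∑ m : Fin 2 → ZMod L,
          if (2 * Real.pi / (L : ℝ)) ^ 2 * (∑ i : Fin 2, (((m i).valMinAbs : ℤ) : ℝ) ^ 2) ≤ ε ^ 2 then
            ((L : ℂ) ^ 2)⁻¹ • (Matrix.conjTranspose (pairFieldAt dWaveFormFactor L m) *
              pairFieldAt dWaveFormFactor L m)
          else 0) *ᵥ ψ).re ≤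
        50 * ((Finset.univ.filter fun m : Fin 2 → ZMod L =>
          (2 * Real.pi / (L : ℝ)) ^ 2 * (∑ i : Fin 2, (((m i).valMinAbs : ℤ) : ℝ) ^ 2) ≤ ε ^ 2).card : ℝ) := by
  classical
  set W : Matrix (Finset (Orb (FermionTorus 2 L))) (Finset (Orb (FermionTorus 2 L))) ℂ :=
    ∑ m : Fin 2 → ZMod L,
      if (2 * Real.pi / (L : ℝ)) ^ 2 * (∑ i : Fin 2, (((m i).valMinAbs : ℤ) : ℝ) ^ 2) ≤ ε ^ 2
      then ((L : ℂ) ^ 2)⁻¹ • (Matrix.conjTranspose (pairFieldAt dWaveFormFactor L m) *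
        pairFieldAt dWaveFormFactor L m)
      else 0 with hWdef
  set c : ℝ := ((Finset.univ.filter fun m : Fin 2 → ZMod L =>
      (2 * Real.pi / (L : ℝ)) ^ 2 * (∑ i : Fin 2, (((m i).valMinAbs : ℤ) : ℝ) ^ 2) ≤ ε ^ 2).card : ℝ)
    with hcdef
  set H := hubbardTorus 2 L 1 0 with hHdef
  set K : Submodule ℂ (Fock (Orb (FermionTorus 2 L))) := szSector (2 * n) 0 ⊓
    Module.End.eigenspace (Matrix.toLin' H) ((H.minEnergyOn (szSector (2 * n) 0) : ℝ) : ℂ) with hKdef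
  -- `K ≠ ⊥`: normalised sector ground states exist
  obtain ⟨ψ₀, hψ₀, hψ₀gs⟩ :=
    Summit.HubbardSuperconductivity.NoGo.exists_unit_groundStateInSector_hubbardTorus L 1 0 hn
  have hK0 : K ≠ ⊥ := by
    intro hbot
    have hmem : ψ₀ ∈ K := by
      rw [hKdef, Submodule.mem_inf, Module.End.mem_eigenspace_iff, Matrix.toLin'_apply]
      exact ⟨hψ₀gs.1, hψ₀gs.2.2⟩
    rw [hbot, Submodule.mem_bot] at hmem
    exact hψ₀gs.2.1 hmem
  -- the flat free bound on the ground eigen-projection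
  have hup := re_trace_sectorEigenProj_mul_kacWindow_le_free hL (2 * n) 0
    ((H.minEnergyOn (szSector (2 * n) 0) : ℝ) : ℂ) ε
  simp only [] at hup
  -- pigeonhole over an orthonormal frame of `K`, applied to `-W`
  obtain ⟨ψ, hψK, hψ1, hle⟩ := exists_unit_le_re_of_trace_projMatrix_map K hK0 (-W) (-(50 * c)) (by
    rw [Matrix.mul_neg, Matrix.trace_neg, Complex.neg_re, neg_mul]
    exact neg_le_neg hup)
  refine ⟨ψ, hψ1, ?_, ?_⟩
  · rw [hKdef, Submodule.mem_inf, Module.End.mem_eigenspace_iff, Matrix.toLin'_apply] at hψK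
    have hψ0 : ψ ≠ 0 := by
      rintro rfl
      simp at hψ1
    exact ⟨hψK.1, hψ0, hψK.2⟩
  · rw [Matrix.neg_mulVec, dotProduct_neg, Complex.neg_re] at hle
    linarith

/-! ### The interaction budget -/

omit [NeZero L] in
/-- **The sector energy is non-decreasing in the repulsion**: for `U ≥ 0` and any sector `K`
containing a unit vector, `minEnergyOn (hubbardTorus 2 L 1 0) K ≤ minEnergyOn (hubbardTorus 2 L 1 U) K`
(`H_U = H_0 + U Σ_x n_{x↑}n_{x↓}` with `Σ_x n_{x↑}n_{x↓} ≥ 0`). Bach–Lieb–Solovej (1994) §2;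
Tasaki (2020) §2.1. [folklore] -/
theorem minEnergyOn_hubbardTorus_zero_le {U : ℝ} (hU : 0 ≤ U)
    {K : Submodule ℂ (Fock (Orb (FermionTorus 2 L)))} (hK : ∃ ψ ∈ K, star ψ ⬝ᵥ ψ = 1) :
    (hubbardTorus 2 L 1 0).minEnergyOn K ≤ (hubbardTorus 2 L 1 U).minEnergyOn K := by
  obtain ⟨ψ₀, hψ₀K, hψ₀⟩ := hK
  refine le_csInf ⟨_, ψ₀, hψ₀K, hψ₀, rfl⟩ ?_
  rintro E ⟨ψ, hψK, hψ1, rfl⟩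
  rw [hubbardTorus_eq_zero_add_smul_interaction U, add_mulVec, dotProduct_add, Complex.add_re,
    smul_mulVec, dotProduct_smul, smul_eq_mul, Complex.re_ofReal_mul]
  have h1 := minEnergyOn_le_re_rayleigh (hubbardTorus 2 L 1 0) K hψK hψ1
  have h2 := mul_nonneg hU (re_expect_interaction_torus_mem_Icc ψ).1
  linarith

/-- **Interaction budget of the window excess.** For `U ≥ 0`, `λ ≥ 0`, any `ε`, `L ≥ 3` and
`n ≤ L²`, with `H_U = hubbardTorus 2 L 1 U`, `K = szSector (2n) 0` and the crux's Kac-window pair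
penalty `W_ε`:
`minEnergyOn (H_U + λW_ε) K − minEnergyOn H_U K ≤ U·L² + λ · 50 · #{m : |q_m| ≤ ε}`.
Proof: test `H_U + λW_ε` on the pair-poor free ground state `ψ` of
`exists_unit_freeGroundState_kacWindow_le`: `Re ⟨ψ, (H_U + λW_ε)ψ⟩ = minEnergyOn H_0 K + U Re⟨ψ, Dψ⟩ +
λ Re⟨ψ, W_εψ⟩ ≤ minEnergyOn H_U K + U L² + 50λ·#window` (`Re⟨ψ, Dψ⟩ ≤ L²`,
`minEnergyOn_hubbardTorus_zero_le`). Bach–Lieb–Solovej (1994) §2; Tasaki (2020) §2.1. [folklore] -/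
theorem windowGap_le_coupling_add_freeWindow (hL : 3 ≤ L) {U : ℝ} (hU : 0 ≤ U) {lam : ℝ}
    (hlam : 0 ≤ lam) (ε : ℝ) {n : ℕ} (hn : n ≤ L ^ 2) :
    (hubbardTorus 2 L 1 U + (lam : ℂ) • (∑ m : Fin 2 → ZMod L,
        if (2 * Real.pi / (L : ℝ)) ^ 2 * (∑ i : Fin 2, (((m i).valMinAbs : ℤ) : ℝ) ^ 2) ≤ ε ^ 2 then
          ((L : ℂ) ^ 2)⁻¹ • (Matrix.conjTranspose (pairFieldAt dWaveFormFactor L m) *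
            pairFieldAt dWaveFormFactor L m)
        else 0)).minEnergyOn (szSector (Λ := FermionTorus 2 L) (2 * n) 0) -
      (hubbardTorus 2 L 1 U).minEnergyOn (szSector (Λ := FermionTorus 2 L) (2 * n) 0) ≤
      U * (L : ℝ) ^ 2 + lam * (50 * ((Finset.univ.filter fun m : Fin 2 → ZMod L =>
          (2 * Real.pi / (L : ℝ)) ^ 2 * (∑ i : Fin 2, (((m i).valMinAbs : ℤ) : ℝ) ^ 2) ≤ ε ^ 2).card : ℝ)) := by
  set W : Matrix (Finset (Orb (FermionTorus 2 L))) (Finset (Orb (FermionTorus 2 L))) ℂ :=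
    ∑ m : Fin 2 → ZMod L,
      if (2 * Real.pi / (L : ℝ)) ^ 2 * (∑ i : Fin 2, (((m i).valMinAbs : ℤ) : ℝ) ^ 2) ≤ ε ^ 2
      then ((L : ℂ) ^ 2)⁻¹ • (Matrix.conjTranspose (pairFieldAt dWaveFormFactor L m) *
        pairFieldAt dWaveFormFactor L m)
      else 0 with hWdef
  set c : ℝ := ((Finset.univ.filter fun m : Fin 2 → ZMod L =>
      (2 * Real.pi / (L : ℝ)) ^ 2 * (∑ i : Fin 2, (((m i).valMinAbs : ℤ) : ℝ) ^ 2) ≤ ε ^ 2).card : ℝ)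
    with hcdef
  obtain ⟨ψ, hψ1, hgs, hWψ⟩ := exists_unit_freeGroundState_kacWindow_le hL hn ε
  -- the variational principle at `ψ` for the penalised interacting operator
  have hvar := minEnergyOn_le_re_rayleigh (hubbardTorus 2 L 1 U + (lam : ℂ) • W)
    (szSector (Λ := FermionTorus 2 L) (2 * n) 0) hgs.1 hψ1
  -- its Rayleigh quotient, term by term
  have he : (star ψ ⬝ᵥ (hubbardTorus 2 L 1 0 *ᵥ ψ)).re =
      (hubbardTorus 2 L 1 0).minEnergyOn (szSector (Λ := FermionTorus 2 L) (2 * n) 0) := by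
    rw [hgs.2.2, dotProduct_smul, hψ1, smul_eq_mul, mul_one, Complex.ofReal_re]
  have hexp : (star ψ ⬝ᵥ ((hubbardTorus 2 L 1 U + (lam : ℂ) • W) *ᵥ ψ)).re =
      (hubbardTorus 2 L 1 0).minEnergyOn (szSector (Λ := FermionTorus 2 L) (2 * n) 0) +
        U * (star ψ ⬝ᵥ ((∑ x : FermionTorus 2 L, numberOp x 0 * numberOp x 1 :
          Matrix (Finset (Orb (FermionTorus 2 L))) _ ℂ) *ᵥ ψ)).re +
        lam * (star ψ ⬝ᵥ (W *ᵥ ψ)).re := by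
    rw [add_mulVec, dotProduct_add, Complex.add_re, smul_mulVec, dotProduct_smul, smul_eq_mul,
      Complex.re_ofReal_mul, hubbardTorus_eq_zero_add_smul_interaction U, add_mulVec, dotProduct_add,
      Complex.add_re, smul_mulVec, dotProduct_smul, smul_eq_mul, Complex.re_ofReal_mul, he]
  -- the three estimates
  have hD := (re_expect_interaction_torus_mem_Icc ψ).2
  rw [hψ1, Complex.one_re, mul_one] at hD
  have hmono : (hubbardTorus 2 L 1 0).minEnergyOn (szSector (Λ := FermionTorus 2 L) (2 * n) 0) ≤
      (hubbardTorus 2 L 1 U).minEnergyOn (szSector (Λ := FermionTorus 2 L) (2 * n) 0) :=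
    minEnergyOn_hubbardTorus_zero_le hU ⟨ψ, hgs.1, hψ1⟩
  have h1 := mul_le_mul_of_nonneg_left hD hU
  have h2 := mul_le_mul_of_nonneg_left hWψ hlam
  rw [hexp] at hvar
  linarith

/-- **Interaction budget, counted window** (`ε ≥ 0`): for `U ≥ 0`, `λ ≥ 0`, `L ≥ 3`, `n ≤ L²`,
`minEnergyOn (H_U + λW_ε) K − minEnergyOn H_U K ≤ U·L² + 50λ(2⌊εL/2π⌋ + 1)²` (`card_window_le`).
[folklore] -/
theorem windowGap_le_coupling_add_freeWindow' (hL : 3 ≤ L) {U : ℝ} (hU : 0 ≤ U) {lam : ℝ}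
    (hlam : 0 ≤ lam) {ε : ℝ} (hε : 0 ≤ ε) {n : ℕ} (hn : n ≤ L ^ 2) :
    (hubbardTorus 2 L 1 U + (lam : ℂ) • (∑ m : Fin 2 → ZMod L,
        if (2 * Real.pi / (L : ℝ)) ^ 2 * (∑ i : Fin 2, (((m i).valMinAbs : ℤ) : ℝ) ^ 2) ≤ ε ^ 2 then
          ((L : ℂ) ^ 2)⁻¹ • (Matrix.conjTranspose (pairFieldAt dWaveFormFactor L m) *
            pairFieldAt dWaveFormFactor L m)
        else 0)).minEnergyOn (szSector (Λ := FermionTorus 2 L) (2 * n) 0) -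
      (hubbardTorus 2 L 1 U).minEnergyOn (szSector (Λ := FermionTorus 2 L) (2 * n) 0) ≤
      U * (L : ℝ) ^ 2 + 50 * lam * (2 * ⌊ε * L / (2 * Real.pi)⌋₊ + 1 : ℝ) ^ 2 := by
  have h := windowGap_le_coupling_add_freeWindow hL hU hlam ε hn
  have hc := (Nat.cast_le (α := ℝ)).2 (card_window_le (L := L) hε)
  push_cast at hc
  have h50 := mul_le_mul_of_nonneg_left hc (by positivity : (0 : ℝ) ≤ lam * 50)
  linarith

/-! ### Consequences for witnesses of the crux body -/

/-- **Witness box from the interaction budget.** If at `(U, δ)` with `U ≥ 0`, `δ ≥ −1` the crux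
inequality `λ(Cε + a)L² ≤ minEnergyOn (H_L + λW_ε) K_L − minEnergyOn H_L K_L` holds for all even
`L ≥ L₀` (`λ, ε ≥ 0`, `C, a` arbitrary reals), then `λ(Cε + a) ≤ U + 50λε²/π²`: divide the counted
interaction budget `≤ U L² + 50λ(εL/π + 1)²` by `L²` and let `L → ∞`. [folklore] -/
theorem windowGap_coupling_mul_consts_le_coupling {U δ C ε lam a : ℝ} (hU : 0 ≤ U) (hδ : -1 ≤ δ)
    (hε : 0 ≤ ε) (hlam : 0 ≤ lam) {L₀ : ℕ}
    (h : ∀ (L : ℕ) [NeZero L], L₀ ≤ L → Even L →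
      lam * (C * ε + a) * (L : ℝ) ^ 2 ≤
        (hubbardTorus 2 L 1 U + (lam : ℂ) • (∑ m : Fin 2 → ZMod L,
            if (2 * Real.pi / (L : ℝ)) ^ 2 * (∑ i : Fin 2, (((m i).valMinAbs : ℤ) : ℝ) ^ 2) ≤ ε ^ 2
            then ((L : ℂ) ^ 2)⁻¹ • (Matrix.conjTranspose (pairFieldAt dWaveFormFactor L m) *
              pairFieldAt dWaveFormFactor L m)
            else 0)).minEnergyOn (szSector (2 * ⌊(1 - δ) * (L : ℝ) ^ 2 / 2⌋₊) 0) -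
          (hubbardTorus 2 L 1 U).minEnergyOn (szSector (2 * ⌊(1 - δ) * (L : ℝ) ^ 2 / 2⌋₊) 0)) :
    lam * (C * ε + a) ≤ U + 50 * lam * ε ^ 2 / Real.pi ^ 2 := by
  by_contra hcon
  have hlt := not_le.mp hcon
  have hπ0 : 0 < Real.pi := Real.pi_pos
  -- the excess rate `η > 0` and the linear-in-`L` slack `S = 100λε/π + 50λ`
  set η : ℝ := lam * (C * ε + a) - (U + 50 * lam * ε ^ 2 / Real.pi ^ 2) with hη
  have hηpos : 0 < η := by rw [hη]; linarith
  set S : ℝ := 100 * lam * ε / Real.pi + 50 * lam with hS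
  have hS0 : 0 ≤ S := by rw [hS]; positivity
  -- an even side `L ≥ max L₀ 3` with `η L > S`
  set T : ℕ := max (max L₀ 3) (⌈S / η⌉₊ + 1) with hT
  set L : ℕ := 2 * T with hLdef
  have hTL : T ≤ L := by omega
  have hL₀ : L₀ ≤ L := le_trans ((le_max_left _ _).trans (le_max_left _ _)) hTL
  have hL3 : 3 ≤ L := le_trans ((le_max_right _ _).trans (le_max_left _ _)) hTL
  have hE : Even L := ⟨T, by omega⟩
  haveI : NeZero L := ⟨by omega⟩
  have hL1 : (1 : ℝ) ≤ (L : ℝ) := by exact_mod_cast (le_trans (by norm_num) hL3)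
  have hSL : S < η * (L : ℝ) := by
    have h1 : S / η ≤ (⌈S / η⌉₊ : ℝ) := Nat.le_ceil _
    have h2 : (⌈S / η⌉₊ : ℝ) + 1 ≤ (T : ℝ) := by
      have : ⌈S / η⌉₊ + 1 ≤ T := le_max_right _ _
      exact_mod_cast this
    have h3 : (T : ℝ) ≤ (L : ℝ) := by exact_mod_cast hTL
    have h4 : S / η < (L : ℝ) := by linarith only [h1, h2, h3]
    rwa [div_lt_iff₀ hηpos, mul_comm] at h4
  -- the budget at this `L`
  have hn : ⌊(1 - δ) * (L : ℝ) ^ 2 / 2⌋₊ ≤ L ^ 2 := Summit.HubbardSuperconductivity.NoGo.floor_pairNumber_le δ hδ L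
  have hgap := h L hL₀ hE
  have hbud := windowGap_le_coupling_add_freeWindow' (L := L) hL3 hU hlam hε hn
  have hmain := hgap.trans hbud
  -- `(2⌊εL/2π⌋ + 1)² ≤ (εL/π + 1)²`
  have hJle : (⌊ε * L / (2 * Real.pi)⌋₊ : ℝ) ≤ ε * L / (2 * Real.pi) :=
    Nat.floor_le (div_nonneg (mul_nonneg hε (Nat.cast_nonneg _)) (by positivity))
  have hJ' : 2 * (⌊ε * L / (2 * Real.pi)⌋₊ : ℝ) + 1 ≤ ε * L / Real.pi + 1 := by
    have : 2 * (ε * L / (2 * Real.pi)) = ε * L / Real.pi := by field_simp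
    linarith only [hJle, this]
  have hsq : (2 * ⌊ε * L / (2 * Real.pi)⌋₊ + 1 : ℝ) ^ 2 ≤ (ε * L / Real.pi + 1) ^ 2 :=
    pow_le_pow_left₀ (by positivity) hJ' 2
  have h50 := mul_le_mul_of_nonneg_left hsq (by positivity : (0 : ℝ) ≤ 50 * lam)
  -- expand `50λ(εL/π + 1)² = 50λε²L²/π² + (100λε/π)L + 50λ`
  have hexp : 50 * lam * (ε * L / Real.pi + 1) ^ 2 =
      50 * lam * ε ^ 2 / Real.pi ^ 2 * (L : ℝ) ^ 2 + 100 * lam * ε / Real.pi * L + 50 * lam := by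
    field_simp
    ring
  -- so `η L² ≤ S·L`, i.e. `η L ≤ S` — contradiction
  have hkey : η * (L : ℝ) ^ 2 ≤ S * L := by
    have hSL' : 100 * lam * ε / Real.pi * L + 50 * lam ≤ S * L := by
      rw [hS, add_mul]
      have : 50 * lam ≤ 50 * lam * (L : ℝ) := le_mul_of_one_le_right (by positivity) hL1
      linarith only [this]
    have : η * (L : ℝ) ^ 2 = lam * (C * ε + a) * (L : ℝ) ^ 2 -
        (U * (L : ℝ) ^ 2 + 50 * lam * ε ^ 2 / Real.pi ^ 2 * (L : ℝ) ^ 2) := by rw [hη]; ring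
    rw [this]
    linarith only [hmain, h50, hexp, hSL']
  have hL0 : (0 : ℝ) < (L : ℝ) := by linarith only [hL1]
  have : η * (L : ℝ) ≤ S := by
    have h' : η * (L : ℝ) * L ≤ S * L := by nlinarith only [hkey]
    exact le_of_mul_le_mul_right h' hL0
  linarith only [this, hSL]

/-- **The penalty budget of a witness is at most the coupling: `λ·a ≤ U`.** Under the hypotheses
of `windowGap_coupling_mul_consts_le_coupling` and `C ≥ 50ε/π²` (the crux's adversarial tail
allowance absorbs the flat free window weight; e.g. `C ≥ 6`, `ε ≤ 1`), `λ·a ≤ U`. At `U = 0` this is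
the free-point refutation `not_windowGapAt_zero` again; for `U > 0` it says the extensive window excess
is bought with interaction energy only. [folklore] -/
theorem windowGap_coupling_mul_le_coupling {U δ C ε lam a : ℝ} (hU : 0 ≤ U) (hδ : -1 ≤ δ)
    (hε : 0 ≤ ε) (hlam : 0 ≤ lam) (hC : 50 * ε / Real.pi ^ 2 ≤ C) {L₀ : ℕ}
    (h : ∀ (L : ℕ) [NeZero L], L₀ ≤ L → Even L →
      lam * (C * ε + a) * (L : ℝ) ^ 2 ≤
        (hubbardTorus 2 L 1 U + (lam : ℂ) • (∑ m : Fin 2 → ZMod L,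
            if (2 * Real.pi / (L : ℝ)) ^ 2 * (∑ i : Fin 2, (((m i).valMinAbs : ℤ) : ℝ) ^ 2) ≤ ε ^ 2
            then ((L : ℂ) ^ 2)⁻¹ • (Matrix.conjTranspose (pairFieldAt dWaveFormFactor L m) *
              pairFieldAt dWaveFormFactor L m)
            else 0)).minEnergyOn (szSector (2 * ⌊(1 - δ) * (L : ℝ) ^ 2 / 2⌋₊) 0) -
          (hubbardTorus 2 L 1 U).minEnergyOn (szSector (2 * ⌊(1 - δ) * (L : ℝ) ^ 2 / 2⌋₊) 0)) :
    lam * a ≤ U := by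
  have hbox := windowGap_coupling_mul_consts_le_coupling hU hδ hε hlam h
  have hπ2 : 0 < Real.pi ^ 2 := by positivity
  -- `λ C ε ≥ λ · (50ε/π²) · ε = 50λε²/π²`
  have hCε : 50 * lam * ε ^ 2 / Real.pi ^ 2 ≤ lam * (C * ε) := by
    have h1 : 50 * ε / Real.pi ^ 2 * ε ≤ C * ε := mul_le_mul_of_nonneg_right hC hε
    have h2 := mul_le_mul_of_nonneg_left h1 hlam
    have h3 : lam * (50 * ε / Real.pi ^ 2 * ε) = 50 * lam * ε ^ 2 / Real.pi ^ 2 := by ring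
    linarith only [h2, h3]
  have hsplit : lam * (C * ε + a) = lam * (C * ε) + lam * a := by ring
  linarith only [hbox, hCε, hsplit]

/-- **No witness serves a whole interval of small couplings.** There are no `δ ≥ −1`, constants
`C, ε, λ, a` with `ε ≥ 0`, `C ≥ 50ε/π²`, `λ > 0`, `a > 0`, threshold `L₀` and `U₀ > 0` such that the
crux inequality `λ(Cε + a)L² ≤ minEnergyOn (H_L(U) + λW_ε) K_L − minEnergyOn H_L(U) K_L` holds for EVERY
`U ∈ (0, U₀)` at every even `L ≥ L₀`: by `windowGap_coupling_mul_le_coupling`, `λa ≤ U` for all such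
`U`, absurd. So in `KacWindowPenalty.WindowGap` the witness `(ε, λ, a, L₀)(U)` must degenerate as
`U → 0⁺` with `λ(U)·a(U) ≤ U` — the window analogue of
`LowEnergyRigidity.Negative.lowEnergyRigidity_false_uniformly_near_zero_coupling`, and the continuous
interpolation to `not_windowGapAt_zero`. Consistent with BCS (`a ≍ m² ≍ e^{−c/U²}`). This does NOT
refute the crux. Bach–Lieb–Solovej (1994) §2; Bardeen–Cooper–Schrieffer (1957) §II. [folklore] -/
theorem windowGap_false_uniformly_near_zero_coupling :
    ¬ ∃ δ : ℝ, -1 ≤ δ ∧ ∃ C ε lam a : ℝ, 0 ≤ ε ∧ 50 * ε / Real.pi ^ 2 ≤ C ∧ 0 < lam ∧ 0 < a ∧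
      ∃ L₀ : ℕ, ∃ U₀ : ℝ, 0 < U₀ ∧ ∀ U ∈ Set.Ioo (0 : ℝ) U₀, ∀ (L : ℕ) [NeZero L], L₀ ≤ L → Even L →
        lam * (C * ε + a) * (L : ℝ) ^ 2 ≤
          (hubbardTorus 2 L 1 U + (lam : ℂ) • (∑ m : Fin 2 → ZMod L,
              if (2 * Real.pi / (L : ℝ)) ^ 2 * (∑ i : Fin 2, (((m i).valMinAbs : ℤ) : ℝ) ^ 2) ≤ ε ^ 2
              then ((L : ℂ) ^ 2)⁻¹ • (Matrix.conjTranspose (pairFieldAt dWaveFormFactor L m) *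
                pairFieldAt dWaveFormFactor L m)
              else 0)).minEnergyOn (szSector (2 * ⌊(1 - δ) * (L : ℝ) ^ 2 / 2⌋₊) 0) -
            (hubbardTorus 2 L 1 U).minEnergyOn (szSector (2 * ⌊(1 - δ) * (L : ℝ) ^ 2 / 2⌋₊) 0) := by
  rintro ⟨δ, hδ, C, ε, lam, a, hε, hC, hlam, ha, L₀, U₀, hU₀, h⟩
  -- test at the coupling `U = min (U₀/2) (λa/2)`
  set U : ℝ := min (U₀ / 2) (lam * a / 2) with hUdef
  have hla : 0 < lam * a := mul_pos hlam ha
  have hUpos : 0 < U := lt_min (by linarith) (by linarith)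
  have hUlt : U < U₀ := (min_le_left _ _).trans_lt (by linarith)
  have hUle : U ≤ lam * a / 2 := min_le_right _ _
  have hbox := windowGap_coupling_mul_le_coupling hUpos.le hδ hε hlam.le hC (h U ⟨hUpos, hUlt⟩)
  linarith

end Summit.HubbardSuperconductivity.HubbardSuperconductivity.Theorems.WindowGap.Negative
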